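import Mathlib.Analysis.Convex.StrictConvexBetween
import Mathlib.MeasureTheory.Measure.Lebesgue.VolumeOfBalls
import Summits.AtomisticToContinuum.Crystallization.Theorems.OverbindingBudgetAffineFarFieldCollar

/-!
# Overbinding budget, affine far field — LOCAL crossing and contact classification for the collar tube

Support file for `Summit.AtomisticToContinuum.Crystallization.Theses.OverbindingBudget.RobustDefectLimitWindows`
(sub-problem (2c), leaf SW♭(30), part 27V «Voronoi-cell quadrature of the far field», interface row T3/T4).
Generic, atlas-free sequel to `OverbindingBudgetAffineFarFieldCollar` (T0–T5).

* §1 LOCAL CROSSING (T3-loc). `Collar.sdiff_subset_cthickening_frontier` puts the symmetric difference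
  `Uc₁ ∆ Uc₂` of the reference / actual core unions in ONE tube of uniform half-width `w` about the reference
  collar. Here the half-width is a function `w i` of the cell: a point of the symmetric difference coming from
  cell `i` is within `w i` of a frontier point `z` which is itself within `2 · w i` of the reference cell `K₁ i`
  (`exists_local_crossing`, `exists_local_crossing'`). Consequently, for ANY cover `S k` (`k ∈ I`) of the
  frontier by pieces with assigned widths `W k` satisfying the STAR CONDITION «`S k` meets the
  `2·w i`-neighbourhood of `K₁ i` ⇒ `w i ≤ W k`», the symmetric difference lies in `⋃ k ∈ I, cthickening (W k) (S k)`
  (`symmDiff_subset_biUnion_cthickening`) — the hypothesis shape of `Collar.abs_setIntegral_sub_le_sum` (T5).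
  The star condition is reduced to distances of centres (`star_of_dist`, nonnegative widths): it only involves cells whose site is
  within `r i + 2·w i + ρ k` of the piece's centre.
* §2 CONTACT CLASSIFICATION for genuine Voronoi cells (`Literature…voronoiCell`): a point common to two cells is
  equidistant from the two sites, i.e. lies on the bisector `⟪x − q, w − q⟫ = ‖w − q‖²/2`
  (`inner_eq_of_dist_eq`), so a collar facet lies in the closed CAP half-space of the core cell
  (`inter_voronoiCell_subset_halfspace`), transported to the cell's own frame by a linear isometry
  (`image_inter_halfspace`, `⟪G y, v⟫ = ⟪y, G⁻¹ v⟫`); if the cell about `q` has circumradius `R` and `2R ≤ dist q w` the contact set is at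
  most the midpoint (`inter_voronoiCell_subset_midpoint`), and it is empty when `2R < dist q w`
  (`inter_voronoiCell_eq_empty`).
* §3 PRICING OF POINT CONTACTS: the `W`-tube about a point contact is a closed ball of volume `(4π/3)W³`
  (`cthickening_subset_closedBall_of_subset_singleton`, `toReal_volume_closedBall_three`).

All statements are over `EuclideanSpace ℝ (Fin 3)` with abstract index types; no lattice, pattern or window
enters. [this file; folklore metric geometry]
-/

namespace Summit.AtomisticToContinuum.Crystallization.Theorems.OverbindingBudgetAffineFarFieldCollarLocal

noncomputable section

open Set MeasureTheory Metric
open Literature.Barriers.AtomisticToContinuum (voronoiCell)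
open Summit.AtomisticToContinuum.Crystallization.Theorems.OverbindingBudgetAffineFarFieldCollar
  (exists_mem_frontier_dist_le_of_notMem exists_mem_frontier_dist_le_of_mem_closure
    frontier_biUnion_voronoiCell_subset)

local notation "E3" => EuclideanSpace ℝ (Fin 3)

/-! ## §1 Local crossing: the tube piece near cell `i` has the half-width of cell `i` -/

/-- support (T3-loc): a point `x ∉ A` within `w` of a point `x' ∈ A` is within `w` of a frontier point `z`
of `A` which is within `2w` of `x'`. [this file] -/
theorem exists_mem_frontier_near_of_notMem {A : Set E3} {x x' : E3} {w : ℝ} (hx : x ∉ A)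
    (hx' : x' ∈ A) (hd : dist x x' ≤ w) :
    ∃ z ∈ frontier A, dist x z ≤ w ∧ dist z x' ≤ 2 * w := by
  obtain ⟨z, hz, hzd⟩ := exists_mem_frontier_dist_le_of_notMem hx hx'
  refine ⟨z, hz, hzd.trans hd, ?_⟩
  have h := dist_triangle z x x'
  rw [dist_comm z x] at h
  linarith

/-- support (T3-loc): a point `x ∈ A` within `w` of a point `x'` of `closure Aᶜ` is within `w` of a frontier
point `z` of `A` which is within `2w` of `x'`. [this file] -/
theorem exists_mem_frontier_near_of_mem_closure {A : Set E3} {x x' : E3} {w : ℝ} (hx : x ∈ A)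
    (hx' : x' ∈ closure Aᶜ) (hd : dist x x' ≤ w) :
    ∃ z ∈ frontier A, dist x z ≤ w ∧ dist z x' ≤ 2 * w := by
  obtain ⟨z, hz, hzd⟩ := exists_mem_frontier_dist_le_of_mem_closure hx hx'
  refine ⟨z, hz, hzd.trans hd, ?_⟩
  have h := dist_triangle z x x'
  rw [dist_comm z x] at h
  linarith

/-- support (T3-loc a): a point of the ACTUAL core union outside the REFERENCE core union, lying in the actual
core cell `i`, is within `w i` of a point `z` of the reference collar frontier with `z` within `2·w i` of the
reference cell `K₁ i` — given the cell-wise nearness `K₂ i ∋ x ↦ x' ∈ K₁ i`, `dist x x' ≤ w i`. [this file] -/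
theorem exists_local_crossing {ι : Type*} {C : Set ι} {K₁ K₂ : ι → Set E3} {w : ι → ℝ}
    (h : ∀ i ∈ C, ∀ x ∈ K₂ i, x ∉ ⋃ j ∈ C, K₁ j → ∃ x' ∈ K₁ i, dist x x' ≤ w i) {x : E3}
    (hx : x ∈ (⋃ i ∈ C, K₂ i) \ ⋃ i ∈ C, K₁ i) :
    ∃ i ∈ C, ∃ z ∈ frontier (⋃ j ∈ C, K₁ j),
      dist x z ≤ w i ∧ z ∈ cthickening (2 * w i) (K₁ i) := by
  obtain ⟨hx2, hx1⟩ := hx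
  obtain ⟨i, hi, hxi⟩ := mem_iUnion₂.1 hx2
  obtain ⟨x', hx', hd⟩ := h i hi x hxi hx1
  obtain ⟨z, hz, hz1, hz2⟩ := exists_mem_frontier_near_of_notMem hx1 (mem_biUnion hi hx') hd
  exact ⟨i, hi, z, hz, hz1, mem_cthickening_of_dist_le z x' _ _ hx' hz2⟩

/-- support (T3-loc b): a point of the REFERENCE core union outside the ACTUAL core union lies in some actual
NON-core cell `i` (the actual cells cover space) and is within `w i` of a point `z` of the reference collar
frontier with `z` within `2·w i` of `K₁ i` — given the cell-wise nearness for non-core cells and that a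
reference non-core cell meeting the situation stays in the closure of the complement of the reference core
union (`Collar.voronoiCell_subset_closure_compl`). [this file] -/
theorem exists_local_crossing' {ι : Type*} {C : Set ι} {K₁ K₂ : ι → Set E3} {w : ι → ℝ}
    (hcov : ⋃ i, K₂ i = univ)
    (h : ∀ i ∉ C, ∀ x ∈ K₂ i, x ∈ ⋃ j ∈ C, K₁ j → ∃ x' ∈ K₁ i, dist x x' ≤ w i)
    (hout : ∀ i ∉ C, (K₂ i ∩ ⋃ j ∈ C, K₁ j).Nonempty → K₁ i ⊆ closure (⋃ j ∈ C, K₁ j)ᶜ)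
    {x : E3} (hx : x ∈ (⋃ i ∈ C, K₁ i) \ ⋃ i ∈ C, K₂ i) :
    ∃ i ∉ C, ∃ z ∈ frontier (⋃ j ∈ C, K₁ j),
      dist x z ≤ w i ∧ z ∈ cthickening (2 * w i) (K₁ i) := by
  obtain ⟨hx1, hx2⟩ := hx
  obtain ⟨i, hxi⟩ := mem_iUnion.1 (hcov.symm ▸ mem_univ x : x ∈ ⋃ i, K₂ i)
  have hi : i ∉ C := fun hi => hx2 (mem_biUnion hi hxi)
  obtain ⟨x', hx', hd⟩ := h i hi x hxi hx1
  have hx'c : x' ∈ closure (⋃ j ∈ C, K₁ j)ᶜ := hout i hi ⟨x, hxi, hx1⟩ hx'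
  obtain ⟨z, hz, hz1, hz2⟩ := exists_mem_frontier_near_of_mem_closure hx1 hx'c hd
  exact ⟨i, hi, z, hz, hz1, mem_cthickening_of_dist_le z x' _ _ hx' hz2⟩

/-- support (T3-loc c, STAR BOOKING): if the reference collar frontier is covered by pieces `S k`, `k ∈ I`
(facets, point contacts, …) carrying widths `W k`, and every cell `i` whose reference cell comes within `2·w i`
of a piece `k` has `w i ≤ W k` (the STAR CONDITION), then the symmetric difference of the two core unions lies
in the union of the `W k`-tubes of the pieces — the cover hypothesis of `Collar.abs_setIntegral_sub_le_sum`
(T5) with `P k = cthickening (W k) (S k)` or any prism containing it. [this file] -/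
theorem symmDiff_subset_biUnion_cthickening {ι κ : Type*} {C : Set ι} {K₁ K₂ : ι → Set E3}
    {w : ι → ℝ} (I : Set κ) (S : κ → Set E3) (W : κ → ℝ)
    (hS : frontier (⋃ j ∈ C, K₁ j) ⊆ ⋃ k ∈ I, S k) (hcov : ⋃ i, K₂ i = univ)
    (h : ∀ i ∈ C, ∀ x ∈ K₂ i, x ∉ ⋃ j ∈ C, K₁ j → ∃ x' ∈ K₁ i, dist x x' ≤ w i)
    (h' : ∀ i ∉ C, ∀ x ∈ K₂ i, x ∈ ⋃ j ∈ C, K₁ j → ∃ x' ∈ K₁ i, dist x x' ≤ w i)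
    (hout : ∀ i ∉ C, (K₂ i ∩ ⋃ j ∈ C, K₁ j).Nonempty → K₁ i ⊆ closure (⋃ j ∈ C, K₁ j)ᶜ)
    (hstar : ∀ i, ∀ k ∈ I, (S k ∩ cthickening (2 * w i) (K₁ i)).Nonempty → w i ≤ W k) :
    symmDiff (⋃ i ∈ C, K₁ i) (⋃ i ∈ C, K₂ i) ⊆ ⋃ k ∈ I, cthickening (W k) (S k) := by
  intro x hx
  have key : ∀ i, ∀ z ∈ frontier (⋃ j ∈ C, K₁ j), dist x z ≤ w i →
      z ∈ cthickening (2 * w i) (K₁ i) → x ∈ ⋃ k ∈ I, cthickening (W k) (S k) := by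
    intro i z hz hxz hzi
    obtain ⟨k, hk, hzk⟩ := mem_iUnion₂.1 (hS hz)
    exact mem_biUnion hk
      (cthickening_mono (hstar i k hk ⟨z, hzk, hzi⟩) _ (mem_cthickening_of_dist_le x z _ _ hzk hxz))
  rw [mem_symmDiff] at hx
  rcases hx with ⟨hx1, hx2⟩ | ⟨hx2, hx1⟩
  · obtain ⟨i, -, z, hz, hxz, hzi⟩ := exists_local_crossing' hcov h' hout ⟨hx1, hx2⟩
    exact key i z hz hxz hzi
  · obtain ⟨i, -, z, hz, hxz, hzi⟩ := exists_local_crossing h ⟨hx2, hx1⟩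
    exact key i z hz hxz hzi

/-- support (T3-loc d): if a piece `S ⊆ closedBall c ρ` meets the `t`-neighbourhood of a cell `K ⊆ closedBall q r`
then the centres are within `r + t + ρ`. [this file] -/
theorem dist_le_of_nonempty_inter_cthickening {S K : Set E3} {c q : E3} {ρ r t : ℝ} (ht : 0 ≤ t)
    (hS : S ⊆ closedBall c ρ) (hK : K ⊆ closedBall q r) (h : (S ∩ cthickening t K).Nonempty) :
    dist q c ≤ r + t + ρ := by
  obtain ⟨z, hzS, hzK⟩ := h
  have hzc : dist z c ≤ ρ := mem_closedBall.1 (hS hzS)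
  have hinf : Metric.infEDist z K ≤ ENNReal.ofReal t := mem_cthickening_iff.1 hzK
  refine le_of_forall_pos_lt_add fun ε hε => ?_
  have hlt : Metric.infEDist z K < ENNReal.ofReal (t + ε) :=
    lt_of_le_of_lt hinf ((ENNReal.ofReal_lt_ofReal_iff (by linarith)).2 (by linarith))
  obtain ⟨y, hyK, hzy⟩ := Metric.infEDist_lt_iff.1 hlt
  rw [edist_lt_ofReal] at hzy
  have hyq : dist y q ≤ r := mem_closedBall.1 (hK hyK)
  have h1 := dist_triangle q y c
  have h2 := dist_triangle y z c
  rw [dist_comm q y] at h1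
  rw [dist_comm y z] at h2
  linarith

/-- support (T3-loc e): hence the STAR CONDITION of `symmDiff_subset_biUnion_cthickening` follows from its
restriction to the cells whose SITE `q i` is within `r i + 2·w i + ρ k` of the piece's centre `c k` — for
reference cells of circumradius `r i` and pieces of radius `ρ k`; in a crystalline far field this is a
bounded «vertex star» of sites per piece. [this file] -/
theorem star_of_dist {ι κ : Type*} {K₁ : ι → Set E3} {S : κ → Set E3} {I : Set κ} {q : ι → E3}
    {c : κ → E3} {r w : ι → ℝ} {ρ W : κ → ℝ} (hw : ∀ i, 0 ≤ w i)
    (hK : ∀ i, K₁ i ⊆ closedBall (q i) (r i)) (hS : ∀ k ∈ I, S k ⊆ closedBall (c k) (ρ k))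
    (h : ∀ i, ∀ k ∈ I, dist (q i) (c k) ≤ r i + 2 * w i + ρ k → w i ≤ W k) :
    ∀ i, ∀ k ∈ I, (S k ∩ cthickening (2 * w i) (K₁ i)).Nonempty → w i ≤ W k :=
  fun i k hk hne => h i k hk
    (dist_le_of_nonempty_inter_cthickening (by linarith [hw i]) (hS k hk) (hK i) hne)

/-- support (T2, product-indexed): the reference collar frontier is covered by the contact sets of the pairs
(core site, non-core site) — `Collar.frontier_biUnion_voronoiCell_subset` re-indexed by `C ×ˢ (Z \ C)` for
use as the piece family of `symmDiff_subset_biUnion_cthickening`. [this file] -/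
theorem frontier_subset_biUnion_prod {Z C : Set E3} (hZ : ∀ (p : E3) (r : ℝ), (Z ∩ closedBall p r).Finite)
    (hC : C ⊆ Z) :
    frontier (⋃ z ∈ C, voronoiCell Z z) ⊆
      ⋃ p ∈ C ×ˢ (Z \ C), voronoiCell Z p.1 ∩ voronoiCell Z p.2 := by
  intro x hx
  obtain ⟨z, hz, hx'⟩ := mem_iUnion₂.1 (frontier_biUnion_voronoiCell_subset hZ hC hx)
  obtain ⟨w, hw, hxw⟩ := mem_iUnion₂.1 hx'
  exact mem_biUnion (mk_mem_prod hz hw) hxw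

/-! ## §2 Contact classification for genuine Voronoi cells -/

variable {Z : Set E3}

/-- support (T4-con a): a point common to the cells of two sites is equidistant from them. [this file] -/
theorem dist_eq_of_mem_inter {q w x : E3} (hq : q ∈ Z) (hw : w ∈ Z)
    (hx : x ∈ voronoiCell Z q ∩ voronoiCell Z w) : dist x q = dist x w :=
  le_antisymm (hx.1 w hw) (hx.2 q hq)

/-- support (T4-con b): the bisector in inner-product form: `dist x q = dist x w` iff
`⟪x − q, w − q⟫ = ‖w − q‖²/2` (forward direction). [this file] -/
theorem inner_eq_of_dist_eq {q w x : E3} (h : dist x q = dist x w) :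
    inner ℝ (x - q) (w - q) = ‖w - q‖ ^ 2 / 2 := by
  have h1 : ‖x - w‖ = ‖x - q‖ := by rw [← dist_eq_norm, ← dist_eq_norm, h]
  have h2 : x - w = (x - q) - (w - q) := by abel
  have h3 : ‖(x - q) - (w - q)‖ ^ 2 =
      ‖x - q‖ ^ 2 - 2 * inner ℝ (x - q) (w - q) + ‖w - q‖ ^ 2 := norm_sub_sq_real _ _
  rw [← h2, h1] at h3
  linarith

/-- support (T4-con c): a COLLAR FACET — the contact set of the cells of two sites — lies in the closed CAP
half-space `‖w − q‖²/2 ≤ ⟪x − q, w − q⟫` of the first cell (with equality; the inequality is the shape of the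
cap-in-prism lemmas `…CellFacets.rdCell_cap_subset_prism` at `ε = 0`). [this file] -/
theorem inter_voronoiCell_subset_halfspace {q w : E3} (hq : q ∈ Z) (hw : w ∈ Z) :
    voronoiCell Z q ∩ voronoiCell Z w ⊆
      voronoiCell Z q ∩ {x | ‖w - q‖ ^ 2 / 2 ≤ inner ℝ (x - q) (w - q)} :=
  fun _ hx => ⟨hx.1, (inner_eq_of_dist_eq (dist_eq_of_mem_inter hq hw hx)).ge⟩

/-- support (T4-con d): TRANSPORT of a cap half-space to the cell's own frame: for a cell presented as
`q + G '' K₀` with `G` a linear isometry, intersecting with `{β ≤ ⟪x − q, v⟫}` is the image of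
`K₀ ∩ {β ≤ ⟪y, G⁻¹ v⟫}`. [this file] -/
theorem image_inter_halfspace (G : E3 ≃ₗᵢ[ℝ] E3) (q v : E3) (K₀ : Set E3) (β : ℝ) :
    (fun y => q + G y) '' K₀ ∩ {x | β ≤ inner ℝ (x - q) v} =
      (fun y => q + G y) '' (K₀ ∩ {y | β ≤ inner ℝ y (G.symm v)}) := by
  have key : ∀ y, inner ℝ (G y) v = inner ℝ y (G.symm v) := fun y => by
    rw [← G.inner_map_map y (G.symm v), G.apply_symm_apply]
  ext x
  constructor
  · rintro ⟨⟨y, hy, rfl⟩, hx⟩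
    refine ⟨y, ⟨hy, ?_⟩, rfl⟩
    have hx' : β ≤ inner ℝ (q + G y - q) v := hx
    rwa [add_sub_cancel_left, key] at hx'
  · rintro ⟨y, ⟨hy, hyv⟩, rfl⟩
    refine ⟨⟨y, hy, rfl⟩, ?_⟩
    show β ≤ inner ℝ (q + G y - q) v
    rwa [add_sub_cancel_left, key]

/-- support (T4-con e): if the cell about `q` has circumradius `R` and `2R ≤ dist q w`, the contact set of the
two cells is at most the MIDPOINT of `q` and `w` (equality in the triangle inequality in a strictly convex
space). In a Barlow stacking `R = ν/√2` and the second distance is `√2·ν`, so this covers every NON-neighbour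
pair. [this file] -/
theorem inter_voronoiCell_subset_midpoint {q w : E3} {R : ℝ} (hq : q ∈ Z) (hw : w ∈ Z)
    (hR : ∀ x ∈ voronoiCell Z q, dist x q ≤ R) (hqw : 2 * R ≤ dist q w) :
    voronoiCell Z q ∩ voronoiCell Z w ⊆ {midpoint ℝ q w} := by
  intro x hx
  have hd : dist x q = dist x w := dist_eq_of_mem_inter hq hw hx
  have hxR : dist x q ≤ R := hR x hx.1
  have htri : dist q w ≤ dist q x + dist x w := dist_triangle q x w
  rw [dist_comm q x] at htri
  have h1 : dist q x = dist q w / 2 := by rw [dist_comm q x]; linarith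
  have h2 : dist x w = dist q w / 2 := by linarith
  exact mem_singleton_iff.2 (eq_midpoint_of_dist_eq_half h1 h2)

/-- support (T4-con f): … and it is EMPTY when `2R < dist q w`. [this file] -/
theorem inter_voronoiCell_eq_empty {q w : E3} {R : ℝ} (hq : q ∈ Z) (hw : w ∈ Z)
    (hR : ∀ x ∈ voronoiCell Z q, dist x q ≤ R) (hqw : 2 * R < dist q w) :
    voronoiCell Z q ∩ voronoiCell Z w = ∅ := by
  ext x
  simp only [mem_empty_iff_false, iff_false]
  intro hx
  have hd : dist x q = dist x w := dist_eq_of_mem_inter hq hw hx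
  have hxR : dist x q ≤ R := hR x hx.1
  have htri : dist q w ≤ dist q x + dist x w := dist_triangle q x w
  rw [dist_comm q x] at htri
  linarith

/-! ## §3 Pricing of point contacts: the tube about a point is a ball -/

/-- support (T4-con g): the `W`-tube about a piece contained in a point is inside the closed ball of radius `W`.
[Mathlib `cthickening_singleton`] -/
theorem cthickening_subset_closedBall_of_subset_singleton {S : Set E3} {m : E3} (hS : S ⊆ {m}) {W : ℝ}
    (hW : 0 ≤ W) : cthickening W S ⊆ closedBall m W := by
  rw [← cthickening_singleton m hW]
  exact cthickening_subset_of_subset W hS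

/-- support (T4-con h): the price of one point contact of the collar at tube half-width `W`:
`vol(closedBall m W) = (4π/3)·W³` as a real number. [Mathlib `EuclideanSpace.volume_closedBall_fin_three`] -/
theorem toReal_volume_closedBall_three (m : E3) {W : ℝ} (hW : 0 ≤ W) :
    (volume (closedBall m W)).toReal = 4 / 3 * Real.pi * W ^ 3 := by
  rw [EuclideanSpace.volume_closedBall_fin_three, ENNReal.toReal_mul, ENNReal.toReal_pow,
    ENNReal.toReal_ofReal hW, ENNReal.toReal_ofReal (by positivity)]
  ring

end

end Summit.AtomisticToContinuum.Crystallization.Theorems.OverbindingBudgetAffineFarFieldCollarLocal
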